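import Mathlib
import Summits.NavierStokesRegularity.NavierStokesRegularity.Theorems.FilamentSkeletonRssSkeletonJ1RLiaDefectDerivSelfBound
import Summits.NavierStokesRegularity.NavierStokesRegularity.Theorems.FilamentSkeletonRssSkeletonJ1RLiaDefectDerivPartner

/-!
# Crux `SkeletonJ1R` (stmt-NavierStokesRegularity-23610) · line `streamline_kantorovich_R` (skeleton of record v7 `4b067f5f13f71d7e`) ·
# STUB F2-d `stub_liaDefectDerivBL : LiaDefectDerivBL` — THE COLLAR DERIVATIVE RATE OF THE SWITCHED NORMAL DEFECT OF THE LIA FRAME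

Hand `leafhand-ns-filamentskeletonrs-1` (gen 1), `--supports stmt-NavierStokesRegularity-23610`.  MODEL rung, NEGATIVE side of the ladder: a theorem about
the explicit local-induction reference frame of a HYPOTHETICAL filament-type rotating-self-similar blow-up skeleton; the crux 23610 (three stubs left:
L-core′, K-B′, 13R), its heart 23320 and 23612 stay OPEN; nothing here proves, refutes or moves any statement about Navier–Stokes regularity.

THE THEOREM (`stub_liaDefectDerivBL : LiaDefectDerivBL`, statement `…SkeletonJ1RLineDefs` §5): for every general-position straight datum there is `Rb₁ > 0`
such that for all `0 < Rb ≤ Rb₁` there are `Γ₁, C_d` with, for every `Γ ≥ Γ₁` and every datum-sliced frame `(x, M)` at `λ = 1` whose reference is THE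
local-induction reference, on the collar `ℓ² ≤ ‖x_j τ‖² ≤ 2ℓ²`: `ℓ·‖∂_τ swDefect(x) j τ‖ ≤ C_d (√Γ + |τ|)/√(log Γ)`.
Assembly: the split/derivative chain of lead g2 (`…LiaDefectDerivAssembly/…Split/…SplitBounds`, reduction `liaDefectDerivBL_of_self_and_partner_deriv_bounds`),
the partner half B2′ (`…LiaDefectDerivPartner.liaDefectDerivBL_of_self_deriv_bound`, hand g0) and the self half B1′ proved here as `liaDefectDeriv_self_bound`
from the Γ-bookkeeping brick `…LiaDefectDerivSelfBound.selfDerivTerm_bound` (general position `θg = min θd 1`, tilt budget `tiltBudget_exists`,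
`|τ| ≤ 3ℓ` on the closed switched region by `abs_param_le_of_sq_le_two`, projection `‖P⊥v‖ ≤ ‖v‖`). [folklore]
-/

set_option linter.dupNamespace false -- `NavierStokesRegularity.NavierStokesRegularity` path/namespace repetition is the tree convention

noncomputable section

namespace Summit.NavierStokesRegularity.NavierStokesRegularity.Theorems.SkeletonJ1RFrame

open Set Function Filter Real Topology MeasureTheory
open Literature.Analysis.FluidPDE
open Summit.NavierStokesRegularity.NavierStokesRegularity.Theorems.FilamentSkeletonRssSkeletonJ1GSplit (NearStraightJ1G StraightDatum)
open scoped InnerProductSpace BigOperators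

set_option maxHeartbeats 1600000 in
/-- **B1′ — the self half of the remaining F2-d estimate** (hypothesis `hself` of `liaDefectDerivBL_of_self_deriv_bound`), with the quantifier prefix of
`LiaDefectBL`: on the collar, `ℓ·‖P⊥(c_j Ȧ_j − β·(x_j′ × (β⁻¹(x_j″ × W + x_j′ × DW·x_j′)) + x_j″ × x_j″))‖ ≤ Cs (√Γ+|τ|)/√log Γ`. [folklore] -/
theorem liaDefectDeriv_self_bound :
    ∀ (N : ℕ) (δd ρd Λd Rwd θd mw : ℝ) (p t : Fin N → EuclideanSpace ℝ (Fin 3)) (γ : Fin N → ℝ) (α : ℝ) (s₀ : Fin N → ℝ),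
      0 < N → 0 < δd → 0 < ρd → 0 < Rwd → 0 < θd → 0 < mw → StraightDatum N δd ρd Λd Rwd θd mw p t γ α s₀ →
      (∀ j k, j ≠ k → |⟪t j, t k⟫_ℝ| ≤ 1 - θd) →
      ∃ Rb₁ : ℝ, 0 < Rb₁ ∧ ∀ Rb : ℝ, 0 < Rb → Rb ≤ Rb₁ → ∃ (Γ₁ Cs : ℝ), ∀ Γ : ℝ, Γ₁ ≤ Γ →
        ∀ (x : Fin N → ℝ → EuclideanSpace ℝ (Fin 3)) (M : EuclideanSpace ℝ (Fin 3) → EuclideanSpace ℝ (Fin 3)),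
          IsLiaReference Γ Rb p t γ α s₀ x → SlicedFrame Γ ρd 1 Rb p t s₀ x M →
          ∀ j τ, (Rb * Real.sqrt (Γ * Real.log Γ)) ^ 2 ≤ ‖x j τ‖ ^ 2 → ‖x j τ‖ ^ 2 < 2 * (Rb * Real.sqrt (Γ * Real.log Γ)) ^ 2 →
            Rb * Real.sqrt (Γ * Real.log Γ) *
              ‖((Γ * γ j / (4 * Real.pi)) • (∫ σ : ℝ, ((-3 * ⟪x j τ - x j σ, deriv (x j) τ⟫_ℝ *
                    ((‖x j τ - x j σ‖ ^ 2 + Real.exp (-(1 + Real.eulerMascheroniConstant - Real.log 2)) * (1:ℝ)) ^ (5 / 2 : ℝ))⁻¹) •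
                  cross (deriv (x j) σ) (x j τ - x j σ) +
                ((‖x j τ - x j σ‖ ^ 2 + Real.exp (-(1 + Real.eulerMascheroniConstant - Real.log 2)) * (1:ℝ)) ^ (3 / 2 : ℝ))⁻¹ •
                  cross (deriv (x j) σ) (deriv (x j) τ))) -
                liaCoeff Γ γ j • (cross (deriv (x j) τ) ((liaCoeff Γ γ j)⁻¹ • (cross (deriv (deriv (x j)) τ) (ambientField Γ p t γ α s₀ j (x j τ)) +
                    cross (deriv (x j) τ) (fderiv ℝ (ambientField Γ p t γ α s₀ j) (x j τ) (deriv (x j) τ)))) +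
                  cross (deriv (deriv (x j)) τ) (deriv (deriv (x j)) τ))) -
              ⟪(Γ * γ j / (4 * Real.pi)) • (∫ σ : ℝ, ((-3 * ⟪x j τ - x j σ, deriv (x j) τ⟫_ℝ *
                    ((‖x j τ - x j σ‖ ^ 2 + Real.exp (-(1 + Real.eulerMascheroniConstant - Real.log 2)) * (1:ℝ)) ^ (5 / 2 : ℝ))⁻¹) •
                  cross (deriv (x j) σ) (x j τ - x j σ) +
                ((‖x j τ - x j σ‖ ^ 2 + Real.exp (-(1 + Real.eulerMascheroniConstant - Real.log 2)) * (1:ℝ)) ^ (3 / 2 : ℝ))⁻¹ •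
                  cross (deriv (x j) σ) (deriv (x j) τ))) -
                liaCoeff Γ γ j • (cross (deriv (x j) τ) ((liaCoeff Γ γ j)⁻¹ • (cross (deriv (deriv (x j)) τ) (ambientField Γ p t γ α s₀ j (x j τ)) +
                    cross (deriv (x j) τ) (fderiv ℝ (ambientField Γ p t γ α s₀ j) (x j τ) (deriv (x j) τ)))) +
                  cross (deriv (deriv (x j)) τ) (deriv (deriv (x j)) τ)), deriv (x j) τ⟫_ℝ • deriv (x j) τ‖ ≤
              Cs * (Real.sqrt Γ + |τ|) / Real.sqrt (Real.log Γ) := by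
  intro N δd ρd Λd Rwd θd mw p t γ α s₀ hN hδ hρ hRw hθ hmw hSD hGP
  obtain ⟨ht, hsep, -, hparams, hq, -⟩ := hSD
  -- general position with θg = min θd 1 ∈ (0, 1]
  set θg := min θd 1 with hθg
  have hθg0 : 0 < θg := lt_min hθ one_pos
  have hθg1 : θg ≤ 1 := min_le_right _ _
  have hGP' : ∀ j k, j ≠ k → |inner ℝ (t j) (t k)| ≤ 1 - θg := fun j k hjk =>
    (hGP j k hjk).trans (by linarith [min_le_left θd 1])
  -- parameter bounds from the datum
  have hγlo : ∀ k, θd ≤ |γ k| := fun k => (hparams.2.2 k).1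
  have hγhi : ∀ k, |γ k| ≤ θd⁻¹ := fun k => (hparams.2.2 k).2
  have hα : |α| ≤ θd⁻¹ := hparams.2.1
  -- tilt budget
  obtain ⟨θ₁, hθ₁0, hθ₁h, hθ₁A⟩ := tiltBudget_exists θg ρd (fun j => p j + s₀ j • t j) hθg0 hρ
  set Rb₁ : ℝ := min (4 * θ₁) (4 / 5) with hRb₁
  have hRb₁0 : 0 < Rb₁ := lt_min (by positivity) (by norm_num)
  refine ⟨Rb₁, hRb₁0, fun Rb hRb hRbR => ?_⟩
  have hRbθ : Rb / 8 ≤ θ₁ := by have : Rb ≤ 4 * θ₁ := hRbR.trans (min_le_left _ _); linarith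
  have hRb45 : Rb ≤ 4 / 5 := hRbR.trans (min_le_right _ _)
  -- the Γ-bookkeeping brick B1′
  obtain ⟨Cself, Ls, hCself0, hself⟩ := selfDerivTerm_bound N hθ hρ hRw.le hRb
  set Mx : ℝ := max Ls (max ((12 * Rwd / Rb) ^ 2) 1) with hMx
  refine ⟨Real.exp Mx, Cself, fun Γ hΓ x M hx hSF j τ hlow hint => ?_⟩
  -- Γ-level facts
  have hΓe : Real.exp 1 ≤ Γ := (Real.exp_le_exp.2 ((le_max_right _ _).trans (le_max_right _ _))).trans hΓ
  have hΓ1 : 1 < Γ := lt_of_lt_of_le (by have := Real.add_one_lt_exp (one_ne_zero (α := ℝ)); linarith) hΓe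
  have hΓ0 : 0 < Γ := by linarith
  have hlog : Mx ≤ Real.log Γ := (Real.le_log_iff_exp_le hΓ0).2 hΓ
  have hLs : Ls ≤ Real.log Γ := (le_max_left _ _).trans hlog
  have hlog1 : 1 ≤ Real.log Γ := ((le_max_right _ _).trans (le_max_right _ _)).trans hlog
  have hsL : 12 * Rwd / Rb ≤ Real.sqrt (Real.log Γ) := by
    have h : (12 * Rwd / Rb) ^ 2 ≤ Real.log Γ := ((le_max_left _ _).trans (le_max_right _ _)).trans hlog
    have := Real.sqrt_le_sqrt h
    rwa [Real.sqrt_sq (by positivity)] at this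
  have hℓ0 : 0 < Rb * Real.sqrt (Γ * Real.log Γ) := by
    have : 0 < Real.sqrt (Γ * Real.log Γ) := Real.sqrt_pos.2 (by positivity); positivity
  obtain ⟨hSR, -⟩ := hSF
  obtain ⟨-, htilt, -, -⟩ := hSR
  -- on the closed switched region |τ| ≤ 3ℓ; the tangent is a unit vector
  have hτ : |τ| ≤ 3 * Rb * Real.sqrt Γ * Real.sqrt (Real.log Γ) :=
    abs_param_le_of_sq_le_two hx hΓ1 hRb hRb45 j (htilt j) (hq j) hsL hint.le
  have hP1 : ‖deriv (x j) τ‖ = 1 := (hx j).2.1 τ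
  have h := hself hΓ1 hLs hx ht hθg0 hθg1 hGP' hsep j hθ₁0.le hθ₁h (fun k _ => hθ₁A j k) (htilt j) hRbθ (hγlo j) hγhi hα hq hτ
    hlow hint.le
  exact le_trans (mul_le_mul_of_nonneg_left (norm_perpTo_le (deriv (x j) τ) _ hP1) hℓ0.le) h

/-- **STUB F2-d · `stub_liaDefectDerivBL`** — the collar derivative rate of the switched normal defect of the LIA frame (see the module docstring):
the registered stub `LiaDefectDerivBL` of the skeleton of record v7 of line `streamline_kantorovich_R`, BY NAME. [folklore] -/
theorem stub_liaDefectDerivBL : LiaDefectDerivBL :=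
  liaDefectDerivBL_of_self_deriv_bound liaDefectDeriv_self_bound

end Summit.NavierStokesRegularity.NavierStokesRegularity.Theorems.SkeletonJ1RFrame

end
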